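import Mathlib.RingTheory.MvPolynomial.EulerIdentity
import Literature.Computability.AlgebraicComplexity.MignonRessayreBound
import Summits.ValiantsHypothesis.ValiantsHypothesis.Theorems.RefutationDegreeBeyondHessianSosStubEvenTransfer

/-!
# Crux `RefutationDegree.BeyondHessianSos` (stmt-ValiantsHypothesis-5643), line `Sketch` —
# the Hessian toolkit of the kernel-flat argument (and stub `stub_pointChoice`)

Support file (`--supports stmt-ValiantsHypothesis-5643`) for the `+1` step past the Mignon–Ressayre
bound proved in `RefutationDegreeBeyondHessianSosPlusOne.lean` (`dc(per_n) ≥ ⌈n²/2⌉ + 1`, hence the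
semantic half of the crux — infeasibility of `Rep(n, ⌊n²/2⌋ + 1)` — for every odd `n ≥ 3`).
Elementary bookkeeping about a square matrix `B` of affine linear forms whose row `i₀` vanishes at
the origin (the situation after translating a representation `per = det A` to a zero `y₀` of `per`
and multiplying on the left by a constant matrix whose row `i₀` is a left-kernel vector of `A(y₀)`):

* `hess0_det_of_row`, `linPart_det_of_row` — Laplace expansion along the row `i₀` and the product
  rule: the Hessian of `det B` at the origin is `Σ_j ± (a_j b_jᵀ + b_j a_jᵀ)` and its gradient is
  `Σ_j ± M_j(0) a_j`, with `a_j` the linear part of `B i₀ j` (the computation inside the tree's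
  `rank_hess0_det_le_of_row`, Mignon–Ressayre 2004 §2, kept in closed form instead of as a rank
  bound);
* `dotProduct_hess0_det_mulVec_eq_zero`, `linPart_det_dotProduct_eq_zero` — hence the KERNEL FLAT
  `K' = {v : a_j ⬝ v = 0 ∀ j}` is totally isotropic for the Hessian form of `det B` at the origin
  and lies in the kernel of its gradient;
* `linPart_transl_dotProduct_self`, `dotProduct_hess0_transl_mulVec` — Euler's identities at a
  point for a homogeneous `f`: `∇f(y) ⬝ y = d f(y)` and `yᵀ Hess f(y) v = (d-1) ∇f(y) ⬝ v`;
* `stub_pointChoice` — the registered stub "choice of the Mignon–Ressayre point" of the lead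
  skeleton `Cruxes/BeyondHessianSos/Lines/Sketch.lean`, which is the landed
  `EvenTransfer.exists_vecMul_map_eval_ne_zero` (file `…StubEvenTransfer.lean`, same line) at `ℂ`.

The affine bookkeeping (`EvenTransfer.vecMul_map_eval`) and the point choice are imported from the
stub file `RefutationDegreeBeyondHessianSosStubEvenTransfer.lean`, not restated.
-/

noncomputable section

-- single-conjunct layout: Sub = Summit, duplicated namespace component intended
set_option linter.dupNamespace false

namespace Summit.ValiantsHypothesis.ValiantsHypothesis.Theorems.RefutationDegreeBeyondHessianSos

open Literature.Computability.AlgebraicComplexity MvPolynomial Matrix Module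

section DetHessian

variable {K : Type*} [Field K] {σ : Type*}

/-- Product rule for the linear part at the origin:
`∇(fg)(0) = f(0) ∇g(0) + g(0) ∇f(0)`. -/
theorem linPart_mul (f g : MvPolynomial σ K) :
    linPart (f * g) = constantCoeff f • linPart g + constantCoeff g • linPart f := by
  ext s
  simp only [linPart_apply, Pi.add_apply, Pi.smul_apply, smul_eq_mul, Derivation.leibniz,
    map_add, map_mul]

/-- `∇(c f)(0) = c ∇f(0)` for a constant `c`. -/
theorem linPart_C_mul (c : K) (f : MvPolynomial σ K) : linPart (C c * f) = c • linPart f := by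
  ext s
  simp [linPart_apply, Derivation.leibniz]

/-- If the row `i₀` of a matrix `B` of affine linear forms vanishes at the origin, the Hessian of
`det B` at the origin is the symmetrised sum `Σ_j ± (a_j b_jᵀ + b_j a_jᵀ)` with `a_j` the linear
part of `B i₀ j` and `b_j` that of the complementary minor (Laplace expansion along the row `i₀`;
the computation inside `rank_hess0_det_le_of_row`). -/
theorem hess0_det_of_row {n : ℕ} (B : Matrix (Fin (n + 1)) (Fin (n + 1)) (MvPolynomial σ K))
    (i₀ : Fin (n + 1)) (hdeg : ∀ j, (B i₀ j).totalDegree ≤ 1)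
    (hcc : ∀ j, constantCoeff (B i₀ j) = 0) :
    hess0 B.det = ∑ j : Fin (n + 1), ((-1 : K) ^ (i₀ + j : ℕ)) •
      (vecMulVec (linPart (B i₀ j)) (linPart (B.submatrix i₀.succAbove j.succAbove).det) +
        vecMulVec (linPart (B.submatrix i₀.succAbove j.succAbove).det) (linPart (B i₀ j))) := by
  classical
  rw [Matrix.det_succ_row B i₀, map_sum]
  refine Finset.sum_congr rfl fun j _ => ?_
  rw [show ((-1 : MvPolynomial σ K) ^ (i₀ + j : ℕ)) = C ((-1 : K) ^ (i₀ + j : ℕ)) by simp,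
    mul_assoc, hess0_C_mul, hess0_mul, hess0_eq_zero_of_totalDegree_le_one (hdeg j), hcc j]
  simp

/-- Under the same hypothesis, the linear part of `det B` at the origin is a combination of the
linear parts `a_j` of the entries of the row `i₀`. -/
theorem linPart_det_of_row {n : ℕ} (B : Matrix (Fin (n + 1)) (Fin (n + 1)) (MvPolynomial σ K))
    (i₀ : Fin (n + 1)) (hcc : ∀ j, constantCoeff (B i₀ j) = 0) :
    linPart B.det = ∑ j : Fin (n + 1), (((-1 : K) ^ (i₀ + j : ℕ)) *
      constantCoeff (B.submatrix i₀.succAbove j.succAbove).det) • linPart (B i₀ j) := by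
  classical
  rw [Matrix.det_succ_row B i₀]
  ext s
  simp only [linPart_apply, map_sum, Finset.sum_apply, Pi.smul_apply, smul_eq_mul]
  refine Finset.sum_congr rfl fun j _ => ?_
  rw [show ((-1 : MvPolynomial σ K) ^ (i₀ + j : ℕ)) = C ((-1 : K) ^ (i₀ + j : ℕ)) by simp,
    mul_assoc]
  simp only [Derivation.leibniz, pderiv_C, map_add, map_mul, constantCoeff_C, hcc j,
    smul_eq_mul, add_zero, mul_zero]
  ring

variable [Fintype σ]

/-- `v ⬝ (a bᵀ) v' = (a ⬝ v) (b ⬝ v')`. -/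
theorem dotProduct_vecMulVec_mulVec (v a b v' : σ → K) :
    v ⬝ᵥ (vecMulVec a b *ᵥ v') = (a ⬝ᵥ v) * (b ⬝ᵥ v') := by
  simp only [dotProduct, mulVec, vecMulVec_apply]
  rw [Finset.sum_mul_sum]
  refine Finset.sum_congr rfl fun i _ => ?_
  rw [Finset.mul_sum]
  refine Finset.sum_congr rfl fun j _ => ?_
  ring

/-- **Isotropy of the kernel flat, second order**: if the row `i₀` of the affine matrix `B`
vanishes at the origin, the Hessian form of `det B` at the origin vanishes on pairs of vectors
annihilated by the linear parts of the entries of that row. -/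
theorem dotProduct_hess0_det_mulVec_eq_zero {n : ℕ}
    (B : Matrix (Fin (n + 1)) (Fin (n + 1)) (MvPolynomial σ K))
    (i₀ : Fin (n + 1)) (hdeg : ∀ j, (B i₀ j).totalDegree ≤ 1)
    (hcc : ∀ j, constantCoeff (B i₀ j) = 0) (v v' : σ → K)
    (hv : ∀ j, linPart (B i₀ j) ⬝ᵥ v = 0) (hv' : ∀ j, linPart (B i₀ j) ⬝ᵥ v' = 0) :
    v ⬝ᵥ (hess0 B.det *ᵥ v') = 0 := by
  rw [hess0_det_of_row B i₀ hdeg hcc, Matrix.sum_mulVec, dotProduct_sum]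
  refine Finset.sum_eq_zero fun j _ => ?_
  rw [Matrix.smul_mulVec, dotProduct_smul, Matrix.add_mulVec, dotProduct_add,
    dotProduct_vecMulVec_mulVec, dotProduct_vecMulVec_mulVec, hv j, hv' j]
  simp

/-- **Isotropy of the kernel flat, first order**: under the same hypothesis the gradient of
`det B` at the origin annihilates every vector annihilated by the linear parts of the row `i₀`. -/
theorem linPart_det_dotProduct_eq_zero {n : ℕ}
    (B : Matrix (Fin (n + 1)) (Fin (n + 1)) (MvPolynomial σ K))
    (i₀ : Fin (n + 1)) (hcc : ∀ j, constantCoeff (B i₀ j) = 0) (v : σ → K)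
    (hv : ∀ j, linPart (B i₀ j) ⬝ᵥ v = 0) :
    linPart B.det ⬝ᵥ v = 0 := by
  rw [linPart_det_of_row B i₀ hcc, sum_dotProduct]
  refine Finset.sum_eq_zero fun j _ => ?_
  rw [smul_dotProduct, hv j, smul_zero]

end DetHessian

/-! ### Euler identities at a point -/

section Euler

variable {K : Type*} [Field K] {σ : Type*} [Fintype σ]

/-- Euler's identity at a point: `∇f(y) ⬝ y = d · f(y)` for `f` homogeneous of degree `d`. -/
theorem linPart_transl_dotProduct_self {f : MvPolynomial σ K} {d : ℕ} (hf : f.IsHomogeneous d)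
    (y : σ → K) : linPart (transl y f) ⬝ᵥ y = (d : K) * eval y f := by
  simp only [dotProduct, linPart_apply, pderiv_transl, constantCoeff_transl]
  have h := congr_arg (eval y) hf.sum_X_mul_pderiv
  simp only [map_sum, map_mul, eval_X, nsmul_eq_mul, map_natCast] at h
  rw [← h]
  exact Finset.sum_congr rfl fun s _ => mul_comm _ _

/-- Euler's identity at a point, second order: `yᵀ Hess f(y) v = (d-1) · ∇f(y) ⬝ v` for `f`
homogeneous of degree `d`. -/
theorem dotProduct_hess0_transl_mulVec {f : MvPolynomial σ K} {d : ℕ} (hf : f.IsHomogeneous d)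
    (y v : σ → K) :
    y ⬝ᵥ (hess0 (transl y f) *ᵥ v) = ((d - 1 : ℕ) : K) * (linPart (transl y f) ⬝ᵥ v) := by
  have key : ∀ t, ∑ s, y s * eval y (pderiv s (pderiv t f)) =
      ((d - 1 : ℕ) : K) * eval y (pderiv t f) := by
    intro t
    have h := congr_arg (eval y) (hf.pderiv (i := t)).sum_X_mul_pderiv
    simp only [map_sum, map_mul, eval_X, nsmul_eq_mul, map_natCast] at h
    exact h
  simp only [dotProduct, mulVec, hess0_transl, linPart_apply, pderiv_transl, constantCoeff_transl]
  calc ∑ s, y s * ∑ t, eval y (pderiv s (pderiv t f)) * v t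
      = ∑ t, (∑ s, y s * eval y (pderiv s (pderiv t f))) * v t := by
        simp only [Finset.mul_sum, Finset.sum_mul]
        rw [Finset.sum_comm]
        exact Finset.sum_congr rfl fun t _ => Finset.sum_congr rfl fun s _ => by ring
    _ = ∑ t, ((d - 1 : ℕ) : K) * eval y (pderiv t f) * v t := by
        exact Finset.sum_congr rfl fun t _ => by rw [key t]
    _ = ((d - 1 : ℕ) : K) * ∑ t, eval y (pderiv t f) * v t := by
        rw [Finset.mul_sum]
        exact Finset.sum_congr rfl fun t _ => by ring

end Euler

/-! ### The registered stub `stub_pointChoice` -/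

/-- **Stub `stub_pointChoice` of the lead skeleton `Cruxes/BeyondHessianSos/Lines/Sketch.lean`
(registered signature, over `ℂ`)**: for an affine representation `A` of `per_{p+3}` and a non-zero
left-kernel vector `κ` of `A(0)`, some diagonally permuted Mignon–Ressayre point
`y₀ ∘ (swap 0 a × swap 0 a)` has `κ A(·) ≠ 0` — the landed
`EvenTransfer.exists_vecMul_map_eval_ne_zero`. -/
theorem stub_pointChoice {p M : ℕ}
    (A : Matrix (Fin M) (Fin M) (MvPolynomial (Fin (p + 3) × Fin (p + 3)) ℂ))
    (hA : IsAffineDetRepr (perPoly (Fin (p + 3)) ℂ) A) (κ : Fin M → ℂ) (hκ0 : κ ≠ 0)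
    (hκA : Matrix.vecMul κ (A.map MvPolynomial.constantCoeff) = 0) :
    ∃ a : Fin (p + 3), Matrix.vecMul κ
      (A.map (MvPolynomial.eval (mrPoint ℂ p ∘ Prod.map (Equiv.swap 0 a) (Equiv.swap 0 a)))) ≠ 0 :=
  EvenTransfer.exists_vecMul_map_eval_ne_zero A hA κ hκ0 hκA

end Summit.ValiantsHypothesis.ValiantsHypothesis.Theorems.RefutationDegreeBeyondHessianSos
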